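import Mathlib.Analysis.SpecialFunctions.Pow.Real
import Literature.NumberTheory.Sieve.ParityBarrier
import HarnessLib

/-!
# Ford's counterexamples to a fixed-level asymptotic sieve: the local construction

Topic `Literature/NumberTheory/Sieve`, family `parity`. Source: K. Ford, *On Bombieri's asymptotic
sieve*, Trans. Amer. Math. Soc. **357** (2005) 1663–1674 (arXiv math/0401215) [Ford2004], §2
("Overall plan", displays (2.1)–(2.5)) and §3 (Theorem 3 and the proof of Theorem 1).

Ford's Theorem 1 (the tree's barrier entry `Literature.Barriers.Parity.FordFixedLevelBarrier`,
`Literature/Barriers/Parity/FordFixedLevel.lean`) is deduced in [Ford2004] §2, p. 5 ("Deducing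
Theorems 1 and 2 from (2.3)–(2.6) is straightforward") from a LOCAL statement: on each short
interval `I = (x, x + x e^{−c₁√log x}]` one can prescribe reals `a_n`, `n ∈ I`, with

* (2.3) `0 ≤ a_n ≤ 2`;
* (2.4) `∑_{n ∈ I, d ∣ n} a_n = K/d + O((K/d) e^{−c₁√log x})` for every `1 ≤ d ≤ x^{1−ϖ}`,
  `K = |I ∩ ℤ|`, where `ϖ < 1 − ν` ((2.1));
* (2.5) `∑_{n ∈ I} a_n Λ_k(n) = (k + σ θ_k) K (log x)^{k−1} (1 + O_k(e^{−c₁√log x}))` for every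
  `k ≥ 1`, with constants `θ_k > 0` and a sign `σ ∈ {−1, 1}` "which we are free to choose".

This local statement is the content of [Ford2004] Theorem 3 (the construction `a_n = 1 + b_n`,
`b_n = f_α(log p₁/log n, …, log p_r/log n)` on `n = p₁ ⋯ p_r ∈ 𝒞_α`, with (3.9)–(3.13)) combined
with the choice `f_{1_M} = (−1)^{M+1} σ ℓ(u − 1/M; δ)` made in the proof of Theorem 1 (p. 8),
for which `(−1)^{M+1} Z_k = σ θ_k`, `θ_k > 0`. It is vendored here as the named fact
`Ford2004_localConstruction`, in the form actually established on pp. 7–9: the `Λ_k`-clause is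
transcribed for the perturbation `b_n = a_n − 1` ((3.12)–(3.13):
`∑_{n ∈ I} b_n Λ_k(n) = K (log x)^{k−1} [σ θ_k + O_k(e^{−c₁√log x})]`), which is what the
deduction of Theorem 1 consumes together with the prime number theorem for `Λ_k`
(`∑_{n ≤ x} Λ_k(n) ∼ k x (log x)^{k−1}`, in the tree: `Literature.NumberTheory.LFunctions.ChebyshevPsiDeLaValleePoussin_holds`
for `k = 1`, `Literature.NumberTheory.Sieve.BombieriSieve.FI1978_lemma3_rat_explicit` for `k ≥ 2`). (As printed, (2.5) and
(3.9) attach the relative error `e^{−c₁√log x}` also to the unperturbed part `∑_{n ∈ I} Λ_k(n)`,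
for which only `k K (log x)^{k−1}(1 + O(1/log x))` holds when `k ≥ 2`; the deduction on p. 5 is
insensitive to this, and the transcription below does not assert it.)

The assembly "local construction ⇒ Theorem 1" is proved in
`Literature/Barriers/Parity/FordFixedLevelProofs.lean`; the local construction itself (Lemma 2.2
and §3 of [Ford2004]) is to be proved in companion files of this one.

## References

* K. Ford, *On Bombieri's asymptotic sieve*, Trans. AMS 357 (2005), 1663–1674, §§2–3.
-/

noncomputable section

open Finset

namespace Literature.NumberTheory.Sieve

/-- Ford's short-interval length factor `η_c(x) = e^{−c √(log x)}`: the intervals of [Ford2004]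
(2.2) are `I_j = (x_j, x_{j+1}]` with `x_{j+1} = x_j (1 + η_{c₁}(x_j))`, and `e^{−c₁√log x_j}` is
also the relative error in (2.4)–(2.5). [cite: Ford2004, §2 (2.2)] -/
def Ford2004.eta (c x : ℝ) : ℝ :=
  Real.exp (-(c * Real.sqrt (Real.log x)))

/-- `η_c(x) > 0`. [folklore] -/
theorem Ford2004.eta_pos (c x : ℝ) : 0 < Ford2004.eta c x := Real.exp_pos _

/-- `η_c(x) ≤ 1` for `c ≥ 0`. [folklore] -/
theorem Ford2004.eta_le_one {c : ℝ} (hc : 0 ≤ c) (x : ℝ) : Ford2004.eta c x ≤ 1 := by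
  rw [Ford2004.eta, Real.exp_le_one_iff, neg_nonpos]
  exact mul_nonneg hc (Real.sqrt_nonneg _)

/-- `η_c` is non-increasing on `(0, ∞)` for `c ≥ 0`. [folklore] -/
theorem Ford2004.eta_antitone {c : ℝ} (hc : 0 ≤ c) {x y : ℝ} (hx : 0 < x) (hxy : x ≤ y) :
    Ford2004.eta c y ≤ Ford2004.eta c x := by
  rw [Ford2004.eta, Ford2004.eta, Real.exp_le_exp, neg_le_neg_iff]
  exact mul_le_mul_of_nonneg_left (Real.sqrt_le_sqrt (Real.log_le_log hx hxy)) hc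

/-- **Ford's local construction** ([Ford2004] Theorem 3 with the choice of `f_{1_M}` of the proof
of Theorem 1, i.e. properties (2.3)–(2.5) of §2 on one interval). For every `ν ∈ (0, 1)` there
are `ϖ ∈ (0, 1 − ν)` ((2.1)), `c₁ > 0` ((2.2)), constants `θ_k > 0` (`k ≥ 1`), `C`, `C_k` and
thresholds such that for every large `x`, writing `I = (x, x + x e^{−c₁√log x}] ∩ ℤ` and
`K = |I|`, and for either sign `σ ∈ {1, −1}`, there are reals `a_n` with
(2.3) `0 ≤ a_n ≤ 2`;
(2.4) `|∑_{n ∈ I, d ∣ n} a_n − K/d| ≤ C (K/d) e^{−c₁√log x}` for all `1 ≤ d ≤ x^{1−ϖ}`;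
(2.5, perturbation form (3.12)–(3.13)) for every `k ≥ 1` and `x ≥ x_k`:
`|∑_{n ∈ I} (a_n − 1) Λ_k(n) − σ θ_k K (log x)^{k−1}| ≤ C_k K (log x)^{k−1} e^{−c₁√log x}`,
`Λ_k = Literature.generalizedVonMangoldt k`. (The `a_n` are only used on `I`; outside `I` the bound (2.3)
is requested for convenience and is trivially met. Ford states (2.4)–(2.5) for the intervals
`I_j` of the sequence `x_{j+1} = x_j(1 + e^{−c₁√log x_j})` started at an arbitrary large `x₀`;
§3 proves them for every large left end-point `x`, which is the form below. The `k`-dependence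
of the threshold `x_k` is allowed, as in "`O_k`".) [cite: Ford2004, Theorem 3 and §2 (2.1)–(2.5), (3.12)–(3.13)] -/
def Ford2004_localConstruction : Prop :=
  ∀ ν : ℝ, 0 < ν → ν < 1 →
    ∃ ϖ : ℝ, 0 < ϖ ∧ ϖ < 1 - ν ∧
    ∃ c₁ : ℝ, 0 < c₁ ∧
    ∃ θ : ℕ → ℝ, (∀ k, 1 ≤ k → 0 < θ k) ∧
    ∃ (C : ℝ) (Ck xk : ℕ → ℝ) (x₀ : ℝ),
      ∀ x : ℝ, x₀ ≤ x → ∀ σ : ℝ, (σ = 1 ∨ σ = -1) →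
        ∃ a : ℕ → ℝ,
          (∀ n, 0 ≤ a n ∧ a n ≤ 2) ∧
          (∀ d : ℕ, 1 ≤ d → (d : ℝ) ≤ x ^ (1 - ϖ) →
            |(∑ n ∈ (Ioc ⌊x⌋₊ ⌊x + x * Ford2004.eta c₁ x⌋₊).filter (d ∣ ·), a n)
                - ((Ioc ⌊x⌋₊ ⌊x + x * Ford2004.eta c₁ x⌋₊).card : ℝ) / d|
              ≤ C * (((Ioc ⌊x⌋₊ ⌊x + x * Ford2004.eta c₁ x⌋₊).card : ℝ) / d)
                  * Ford2004.eta c₁ x) ∧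
          (∀ k : ℕ, 1 ≤ k → xk k ≤ x →
            |(∑ n ∈ Ioc ⌊x⌋₊ ⌊x + x * Ford2004.eta c₁ x⌋₊,
                  (a n - 1) * generalizedVonMangoldt k n)
                - σ * θ k * ((Ioc ⌊x⌋₊ ⌊x + x * Ford2004.eta c₁ x⌋₊).card : ℝ)
                    * Real.log x ^ (k - 1)|
              ≤ Ck k * ((Ioc ⌊x⌋₊ ⌊x + x * Ford2004.eta c₁ x⌋₊).card : ℝ)
                  * Real.log x ^ (k - 1) * Ford2004.eta c₁ x)

end Literature.NumberTheory.Sieve
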